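import Summits.CriticalPhenomena.PercolationContinuityZ3.Theorems.PercNearOneGluingNoHeavyLowerTailCubicThreePointAGPrW
import Summits.CriticalPhenomena.PercolationContinuityZ3.Theorems.PercNearOneGluingNoHeavyLowerTailCubicThreePointInduction
import Mathlib.Tactic.Ring
import Mathlib.Tactic.Linarith
import HarnessLib

/-!
# `NoHeavyLowerTail` (stmt-CriticalPhenomena-4575) — THEOREM A at the level of graphs: SHK3⁺ survives terminal chords and loops

Support file (prover prim-sahi-p2; `--supports stmt-CriticalPhenomena-4575`).  In the finitary calculus of `…CubicThreePointSections`
(`shk3W D p K a b c = F(law)`): adding to `D` a terminal–terminal edge `{a,b}` of any weight `l ∈ [0,1]` transforms the law by the move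
`E_ab^l` of `…CubicThreePointTerminalClosure` (`cells_insert_ab_*`), so by THEOREM A there (`F_edge_ab_nonneg`, whose side condition
`AG ≥ 0` is automatic by `AG_PrW_nonneg`) `SHK3⁺(D) ⇒ SHK3⁺(D ∪ {ab})` (`shk3W_insert_ab_nonneg`, and `ac`, `bc` by the terminal
symmetries); adding a loop changes nothing (`shk3W_insert_loop`).  Used by `…CubicThreePointFiveVertices` to pass from the theta graph to
all weighted graphs on five vertices.
[cite: Gladkov2024StrongFKG, Cor. 4.2 (AG ≥ 0)]
-/

noncomputable section

namespace Summit.CriticalPhenomena.PercolationContinuityZ3.Theorems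

namespace TerminalGluing

open Finset SimpleGraph Literature.Probability.Percolation Literature.Probability.Percolation.DecisionTree
open CubicThreePointStep CubicThreePointTerminal

variable {V : Type*} [DecidableEq V]

/-! ### The cells after forcing a terminal–terminal edge -/

section ForcedChord

variable (K : Finset (Sym2 V)) {a b : V} (c : V) (hab : a ≠ b)
include hab

/-- With `{a,b}` forced, `a ~ c` iff `a ~ c` or `b ~ c` before. [folklore] -/
theorem R_ac_insert_ab_iff (S : Finset (Sym2 V)) : R (insert s(a, b) K) S a c ↔ R K S a c ∨ R K S b c := by
  constructor
  · intro h
    rcases reach_insert_cases h with h | ⟨_, h⟩ | ⟨h1, h2⟩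
    · exact Or.inl h
    · exact Or.inr h
    · exact Or.inl h2
  · rintro (h | h)
    · exact R_mono_insert _ h
    · exact (R_insert_edge hab).trans (R_mono_insert _ h)

/-- With `{a,b}` forced the cell `a|b|c` is empty. [folklore] -/
theorem not_mem_evQ_insert_ab (S : Finset (Sym2 V)) : S ∉ evQ (insert s(a, b) K) a b c := fun h =>
  (mem_evQ.mp h).1 (R_insert_edge hab)

/-- With `{a,b}` forced the cell `ac|b` is empty. [folklore] -/
theorem not_mem_evU₂_insert_ab (S : Finset (Sym2 V)) : S ∉ evU₂ (insert s(a, b) K) a b c := fun h =>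
  (mem_evU₂.mp h).2 (R_insert_edge hab)

/-- With `{a,b}` forced the cell `bc|a` is empty. [folklore] -/
theorem not_mem_evU₃_insert_ab (S : Finset (Sym2 V)) : S ∉ evU₃ (insert s(a, b) K) a b c := fun h =>
  (mem_evU₃.mp h).2 (R_insert_edge hab)

/-- With `{a,b}` forced, `ab|c` holds iff `a|b|c` or `ab|c` held before. [folklore] -/
theorem ind_evU₁_insert_ab (S : Finset (Sym2 V)) :
    ind (evU₁ (insert s(a, b) K) a b c) S = ind (evQ K a b c) S + ind (evU₁ K a b c) S := by
  by_cases hac : R K S a c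
  · have h1 : S ∉ evU₁ (insert s(a, b) K) a b c := fun h => (mem_evU₁.mp h).2 (R_mono_insert _ hac)
    have h2 : S ∉ evQ K a b c := fun h => (mem_evQ.mp h).2.1 hac
    have h3 : S ∉ evU₁ K a b c := fun h => (mem_evU₁.mp h).2 hac
    rw [ind_of_not_mem h1, ind_of_not_mem h2, ind_of_not_mem h3, add_zero]
  by_cases hbc : R K S b c
  · have h1 : S ∉ evU₁ (insert s(a, b) K) a b c := fun h =>
      (mem_evU₁.mp h).2 ((R_ac_insert_ab_iff K c hab S).mpr (Or.inr hbc))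
    have h2 : S ∉ evQ K a b c := fun h => (mem_evQ.mp h).2.2 hbc
    have h3 : S ∉ evU₁ K a b c := fun h => hac ((mem_evU₁.mp h).1.trans hbc)
    rw [ind_of_not_mem h1, ind_of_not_mem h2, ind_of_not_mem h3, add_zero]
  have h1 : S ∈ evU₁ (insert s(a, b) K) a b c :=
    mem_evU₁.mpr ⟨R_insert_edge hab, fun h => by rcases (R_ac_insert_ab_iff K c hab S).mp h with h | h <;> contradiction⟩
  rw [ind_of_mem h1]
  by_cases hab' : R K S a b
  · have h2 : S ∉ evQ K a b c := fun h => (mem_evQ.mp h).1 hab'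
    rw [ind_of_not_mem h2, ind_of_mem (mem_evU₁.mpr ⟨hab', hac⟩), zero_add]
  · have h3 : S ∉ evU₁ K a b c := fun h => hab' (mem_evU₁.mp h).1
    rw [ind_of_not_mem h3, ind_of_mem (mem_evQ.mpr ⟨hab', hac, hbc⟩), add_zero]

/-- With `{a,b}` forced, `abc` holds iff `abc`, `ac|b` or `bc|a` held before. [folklore] -/
theorem ind_evT_insert_ab (S : Finset (Sym2 V)) :
    ind (evT (insert s(a, b) K) a b c) S = ind (evT K a b c) S + ind (evU₂ K a b c) S + ind (evU₃ K a b c) S := by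
  by_cases h : R K S a c ∨ R K S b c
  · have h1 : S ∈ evT (insert s(a, b) K) a b c := mem_evT.mpr ⟨R_insert_edge hab, (R_ac_insert_ab_iff K c hab S).mpr h⟩
    rw [ind_of_mem h1]
    by_cases hab' : R K S a b
    · have hac : R K S a c := h.elim id (fun hbc => hab'.trans hbc)
      have h2 : S ∉ evU₂ K a b c := fun h' => (mem_evU₂.mp h').2 hab'
      have h3 : S ∉ evU₃ K a b c := fun h' => (mem_evU₃.mp h').2 hab'
      rw [ind_of_mem (mem_evT.mpr ⟨hab', hac⟩), ind_of_not_mem h2, ind_of_not_mem h3]; ring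
    · have hT : S ∉ evT K a b c := fun h' => hab' (mem_evT.mp h').1
      rw [ind_of_not_mem hT]
      rcases h with hac | hbc
      · have h3 : S ∉ evU₃ K a b c := fun h' => hab' ((hac.trans (mem_evU₃.mp h').1.symm))
        rw [ind_of_mem (mem_evU₂.mpr ⟨hac, hab'⟩), ind_of_not_mem h3]; ring
      · by_cases hac : R K S a c
        · exact absurd (hac.trans hbc.symm) hab'
        · have h2 : S ∉ evU₂ K a b c := fun h' => hac (mem_evU₂.mp h').1
          rw [ind_of_not_mem h2, ind_of_mem (mem_evU₃.mpr ⟨hbc, hab'⟩)]; ring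
  · push Not at h
    have h1 : S ∉ evT (insert s(a, b) K) a b c := fun h' => by
      rcases (R_ac_insert_ab_iff K c hab S).mp (mem_evT.mp h').2 with h'' | h''
      · exact h.1 h''
      · exact h.2 h''
    have h2 : S ∉ evT K a b c := fun h' => h.1 (mem_evT.mp h').2
    have h3 : S ∉ evU₂ K a b c := fun h' => h.1 (mem_evU₂.mp h').1
    have h4 : S ∉ evU₃ K a b c := fun h' => h.2 (mem_evU₃.mp h').1
    rw [ind_of_not_mem h1, ind_of_not_mem h2, ind_of_not_mem h3, ind_of_not_mem h4]; ring

end ForcedChord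

/-! ### SHK3⁺ survives a terminal chord -/

/-- `shk3W` is symmetric under `b ↔ c`. [folklore] -/
theorem shk3W_swap23 (D : Finset (Sym2 V)) (p : Sym2 V → ℝ) (K : Finset (Sym2 V)) (a b c : V) :
    shk3W D p K a c b = shk3W D p K a b c := by
  rw [shk3W_swap13 D p K b c a, shk3W_swap12 D p K c b a, shk3W_swap13 D p K a b c]

section Chord

variable (D : Finset (Sym2 V)) {p : Sym2 V → ℝ} (hp0 : ∀ i, 0 ≤ p i) (hp1 : ∀ i, p i ≤ 1) (K : Finset (Sym2 V))
  {a b : V} (c : V)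
include hp0 hp1

/-- **THEOREM A (edge) for graphs.**  If SHK3⁺ holds for `(D, K; a, b, c)` then it holds after adding the terminal chord `{a,b}` with
any weight `p {a,b} ∈ [0,1]` (the law moves by `E_ab^l`; `AG ≥ 0` is automatic). [cite: Gladkov2024StrongFKG, Cor. 4.2] -/
theorem shk3W_insert_ab_nonneg (hab : a ≠ b) (he : s(a, b) ∉ D) (hF : 0 ≤ shk3W D p K a b c) :
    0 ≤ shk3W (insert s(a, b) D) p K a b c := by
  have eQ : PrW (insert s(a, b) D) p (evQ K a b c) = (1 - p s(a, b)) * PrW D p (evQ K a b c) := by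
    rw [PrW_split D p he, sect_evQ, PrW_eq_zero_of_forall D p (fun S _ => not_mem_evQ_insert_ab K c hab S)]; ring
  have eU₁ : PrW (insert s(a, b) D) p (evU₁ K a b c) = PrW D p (evU₁ K a b c) + p s(a, b) * PrW D p (evQ K a b c) := by
    rw [PrW_split D p he, sect_evU₁, PrW_of_ind_add D p (fun S _ => ind_evU₁_insert_ab K c hab S)]; ring
  have eU₂ : PrW (insert s(a, b) D) p (evU₂ K a b c) = (1 - p s(a, b)) * PrW D p (evU₂ K a b c) := by
    rw [PrW_split D p he, sect_evU₂, PrW_eq_zero_of_forall D p (fun S _ => not_mem_evU₂_insert_ab K c hab S)]; ring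
  have eU₃ : PrW (insert s(a, b) D) p (evU₃ K a b c) = (1 - p s(a, b)) * PrW D p (evU₃ K a b c) := by
    rw [PrW_split D p he, sect_evU₃, PrW_eq_zero_of_forall D p (fun S _ => not_mem_evU₃_insert_ab K c hab S)]; ring
  have eT : PrW (insert s(a, b) D) p (evT K a b c) =
      PrW D p (evT K a b c) + p s(a, b) * (PrW D p (evU₂ K a b c) + PrW D p (evU₃ K a b c)) := by
    rw [PrW_split D p he, sect_evT, PrW_of_ind_add3 D p (fun S _ => ind_evT_insert_ab K c hab S)]; ring
  unfold shk3W
  rw [eQ, eU₁, eU₂, eU₃, eT]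
  exact F_edge_ab_nonneg (PrW_nonneg D hp0 hp1 _) (PrW_nonneg D hp0 hp1 _) (PrW_nonneg D hp0 hp1 _)
    (PrW_nonneg D hp0 hp1 _) (PrW_nonneg D hp0 hp1 _) (hp0 _) (hp1 _) (AG_PrW_nonneg a b c hp0 hp1 D K) hF

/-- THEOREM A (edge) for the chord `{a,c}`. [cite: Gladkov2024StrongFKG, Cor. 4.2] -/
theorem shk3W_insert_ac_nonneg (hac : a ≠ c) (he : s(a, c) ∉ D) (hF : 0 ≤ shk3W D p K a b c) :
    0 ≤ shk3W (insert s(a, c) D) p K a b c := by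
  rw [← shk3W_swap23 (insert s(a, c) D) p K a b c]
  rw [← shk3W_swap23 D p K a b c] at hF
  exact shk3W_insert_ab_nonneg D hp0 hp1 K b hac he hF

/-- THEOREM A (edge) for the chord `{b,c}`. [cite: Gladkov2024StrongFKG, Cor. 4.2] -/
theorem shk3W_insert_bc_nonneg (hbc : b ≠ c) (he : s(b, c) ∉ D) (hF : 0 ≤ shk3W D p K a b c) :
    0 ≤ shk3W (insert s(b, c) D) p K a b c := by
  have he' : s(c, b) ∉ D := by rwa [Sym2.eq_swap] at he
  have hF' : 0 ≤ shk3W D p K c b a := by rwa [← shk3W_swap13 D p K a b c] at hF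
  have h := shk3W_insert_ab_nonneg D hp0 hp1 K a (Ne.symm hbc) he' hF'
  rwa [Sym2.eq_swap, shk3W_swap13] at h

end Chord

/-! ### Loops change nothing -/

section Loop

variable (D : Finset (Sym2 V)) (p : Sym2 V → ℝ) (K : Finset (Sym2 V)) (a b c : V) {v : V}

/-- A forced loop does not change reachability. [folklore] -/
theorem R_insert_loop_iff (S : Finset (Sym2 V)) (x y : V) : R (insert s(v, v) K) S x y ↔ R K S x y := by
  constructor
  · intro h
    rcases reach_insert_cases h with h | ⟨h1, h2⟩ | ⟨h1, h2⟩
    · exact h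
    · exact h1.trans h2
    · exact h1.trans h2
  · exact R_mono_insert _

/-- Adding a loop to `D` does not change `shk3W`. [folklore] -/
theorem shk3W_insert_loop (he : s(v, v) ∉ D) : shk3W (insert s(v, v) D) p K a b c = shk3W D p K a b c := by
  have key : ∀ X : Set (Finset (Sym2 V)), (∀ S, insert s(v, v) S ∈ X ↔ S ∈ X) → PrW (insert s(v, v) D) p X = PrW D p X := by
    intro X hX
    rw [PrW_split D p he]
    have : {S | insert s(v, v) S ∈ X} = X := Set.ext hX
    rw [this]; ring
  unfold shk3W
  rw [key (evQ K a b c) (fun S => by simp only [mem_evQ, R_insert_config_iff, R_insert_loop_iff]),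
    key (evU₁ K a b c) (fun S => by simp only [mem_evU₁, R_insert_config_iff, R_insert_loop_iff]),
    key (evU₂ K a b c) (fun S => by simp only [mem_evU₂, R_insert_config_iff, R_insert_loop_iff]),
    key (evU₃ K a b c) (fun S => by simp only [mem_evU₃, R_insert_config_iff, R_insert_loop_iff]),
    key (evT K a b c) (fun S => by simp only [mem_evT, R_insert_config_iff, R_insert_loop_iff])]

end Loop

end TerminalGluing

end Summit.CriticalPhenomena.PercolationContinuityZ3.Theorems
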